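/-
Copyright (c) 2026. All rights reserved.
Released under Apache 2.0 license as described in the file LICENSE.
Authors: abc-iut cell, wave-4 prover seat abc-iut-w4-d017 (gen 4; proof-only, over abc-iut-S1's `LocalUnitLog` /
`LogSeriesEstimates` / `UnitLogIntoMaximalIdeal` and abc-iut-S7's `RescaledCompletion`).
-/
import Literature.IUT.LogVolume.UnitLogIntoMaximalIdeal
import Literature.NumberTheory.NumberFields.RescaledCompletion
import Mathlib.NumberTheory.NumberField.Cyclotomic.Ideal
import HarnessLib

/-!
# `log_3(𝒪^×) ⊆ 3𝒪 = 𝔪²` for the completion of `ℚ(ζ₃)` at `λ = ζ₃ − 1` (`e = 2 = p − 1`, the boundary case)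

Classical local analysis (Neukirch, *Algebraic Number Theory*, Ch. II (5.5); Koblitz, GTM 58, Ch. IV §1).
For `K = ℚ(ζ₃)` completed at `v = (ζ₃ − 1)`: `K_v = ℚ₃(ζ₃)`, `e = 2`, `f = 1`, uniformizer `λ = ζ₃ − 1` with
`λ² = −3ζ₃`. The generic bound of `UnitLogIntoMaximalIdeal` (`e ≤ p − 1`) gives only `log(𝒪_v^×) ⊆ 𝔪_v`;
here we prove the sharp `log(𝒪_v^×) ⊆ 𝔪_v² = 3𝒪_v`: `1 + 𝔪_v = μ₃ · (1 + 𝔪_v²)` (`λ ∉ 𝔪_v²`,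
`𝒪_v/𝔪_v = 𝔽₃ = {0, 1, −1}`), `log` kills `μ₃`, and `log` is `1`-Lipschitz on `1 + 𝔪_v² = {‖1 − y‖ ≤ 3⁻¹}`
(`3⁻¹ · 3^{1/(3−1)} ≤ 1`). (With `3𝒪_v ⊆ log(𝒪_v^×)`, Neukirch II (5.5), this is `log(𝒪_v^×) = 3𝒪_v`, i.e. the
[IUTchIII] Rmk. 1.2.2 (i) log-shell `I_v = 3⁻¹ · log(𝒪_v^×)` of `ℚ₃(ζ₃)` is exactly `𝒪_v` — consumer:
`Summits/ABC/IUTFork/Cor312RamifiedPlaceLogShell.lean`, GAP row G-c312-14-1 of the abc-iut cell.)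

PROOF-ONLY file (no definitions), in abc-iut-S1's norm-side setting (`unitLog = log_p` over
`[NormedAlgebra ℚ_[p] L] [IsUltrametricDist L] [ProperSpace L]`) and abc-iut-S7's `RescaledCompletion K p v`
(the completion `K_v` re-normed into a normed `ℚ_p`-algebra; same elements, valuation, integers, topology):
* §1 `norm_unitLog_le_of_forall_isPrincipal_twist` — abstract: if every principal unit becomes `ρ`-close to `1`
  after a twist by a root of unity and `ρ · p^{1/(p−1)} ≤ 1`, then `‖log_p u‖ ≤ ρ` for every unit;
* §2 dictionary `K ↔ K_v` (`norm_of_coe_lt_one_iff`, …), discreteness at a generator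
  (`norm_le_norm_of_generator`), approximation by algebraic integers (`exists_int_norm_sub_lt_one`), the residues
  `{0, 1, −1}` modulo `ζ₃ − 1` (`exists_residue_zeta_sub_one`, via Mathlib `𝓞 = ℤ[ζ₃]`), the unique place over
  `3` (`asIdeal_eq_span_zeta_sub_one`), the twist `exists_twist_norm_le`, and the bound
  **`norm_unitLog_le_norm_three`**: `‖log u‖ ≤ ‖3‖` for every unit `u` of the completion.
Nothing here is disputed mathematics and nothing bears on [IUTchIII] Cor. 3.12.
-/

noncomputable section

open Metric Set NumberField IsDedekindDomain

namespace Literature.IUT.LogVolume.CyclotomicThree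

open Literature.NumberTheory.NumberFields

/-! ## §1. Abstract: a Lipschitz radius reached after a torsion twist -/

section Abstract

variable (p : ℕ) [Fact p.Prime]
variable {L : Type*} [NontriviallyNormedField L] [NormedAlgebra ℚ_[p] L] [IsUltrametricDist L]
  [ProperSpace L]

/-- **Twisted Lipschitz bound.** If every principal unit `y` of `L` (`‖1 − y‖ < 1`) satisfies
`‖1 − ζ·y‖ ≤ ρ` for some root of unity `ζ` (depending on `y`), where `ρ · p^{1/(p−1)} ≤ 1` (the
`1`-Lipschitz range of the logarithmic series), then `‖log_p u‖ ≤ ρ` for every unit `u`: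
`log_p u = m⁻¹ · log_p(ζ · u^m)` with `u^m` principal, `p ∤ m` (abc-iut-S1's
`exists_pow_isPrincipal_not_dvd`), `log_p ζ = 0` (`unitLog_eq_zero_of_pow_eq_one`), and
`‖log_p(ζ u^m)‖ = ‖L(ζ u^m)‖ ≤ ‖1 − ζ u^m‖ ≤ ρ` (`norm_logSeries_le_norm`).
[cite: Koblitz1984, Ch. IV §1] -/
theorem norm_unitLog_le_of_forall_isPrincipal_twist {ρ : ℝ}
    (hθ : ρ * (p : ℝ) ^ (1 / ((p : ℝ) - 1)) ≤ 1)
    (hρ : ∀ y : L, IsPrincipal y → ∃ ζ : L, ∃ n : ℕ, 0 < n ∧ ζ ^ n = 1 ∧ ‖1 - ζ * y‖ ≤ ρ)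
    {u : L} (hu : ‖u‖ = 1) : ‖unitLog u‖ ≤ ρ := by
  have hp : p.Prime := Fact.out
  -- `ρ < 1`: `p^{1/(p-1)} > 1`... we only need `ρ < 1` to know the twisted power is principal.
  have hpow : 1 < (p : ℝ) ^ (1 / ((p : ℝ) - 1)) := by
    have hp2 : (2 : ℝ) ≤ p := by exact_mod_cast hp.two_le
    exact Real.one_lt_rpow (by linarith) (div_pos one_pos (by linarith))
  have hρ1 : ρ < 1 := by
    by_contra h
    have h' : 1 ≤ ρ := not_lt.mp h
    have : (1 : ℝ) * (p : ℝ) ^ (1 / ((p : ℝ) - 1)) ≤ ρ * (p : ℝ) ^ (1 / ((p : ℝ) - 1)) := by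
      gcongr
    linarith
  obtain ⟨m, hm0, hmp, hmP⟩ := exists_pow_isPrincipal_not_dvd (p := p) hu
  obtain ⟨ζ, n, hn, hζn, hζy⟩ := hρ _ hmP
  have hζ1 : ‖ζ‖ = 1 := by
    have h1 : ‖ζ‖ ^ n = 1 := by rw [← norm_pow, hζn, norm_one]
    exact (pow_eq_one_iff_of_nonneg (norm_nonneg ζ) hn.ne').mp h1
  have hum : ‖u ^ m‖ = 1 := by rw [norm_pow, hu, one_pow]
  have hP : IsPrincipal (ζ * u ^ m) := lt_of_le_of_lt hζy hρ1
  have hlog : unitLog (ζ * u ^ m) = (m : L) * unitLog u := by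
    rw [unitLog_mul p hζ1 hum, unitLog_eq_zero_of_pow_eq_one p hn hζn, zero_add, unitLog_pow p hu m]
  have hbound : ‖unitLog (ζ * u ^ m)‖ ≤ ρ := by
    rw [unitLog_of_isPrincipal p hP]
    exact (norm_logSeries_le_norm p L hθ hζy).trans hζy
  rw [hlog, norm_mul, norm_natCast_eq_one_of_not_dvd p hmp, one_mul] at hbound
  exact hbound

end Abstract

/-! ## §2. The place `(ζ₃ − 1)` of `ℚ(ζ₃)` inside abc-iut-S7's rescaled completion -/

section Place

variable {K : Type} [Field K] [NumberField K]
variable (p : ℕ) (v : HeightOneSpectrum (𝓞 K)) (hvp : ((p : ℕ) : 𝓞 K) ∈ v.asIdeal)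

/-- Dictionary: for `k ∈ K`, `‖k‖' < 1` in the rescaled completion iff `v(k) < 1`.
[cite: NeukirchANT1999, Ch. II Prop. (3.3)] -/
theorem norm_of_coe_lt_one_iff (k : K) :
    ‖RescaledCompletion.of K p v hvp (algebraMap K (v.adicCompletion K) k)‖ < 1 ↔ v.valuation K k < 1 := by
  rw [Valued.toNormedField.norm_lt_one_iff]
  show Valued.v (k : v.adicCompletion K) < 1 ↔ _
  rw [HeightOneSpectrum.valuedAdicCompletion_eq_valuation']

/-- Dictionary: for `k ∈ K`, `‖k‖' ≤ 1` in the rescaled completion iff `v(k) ≤ 1`.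
[cite: NeukirchANT1999, Ch. II Prop. (3.3)] -/
theorem norm_of_coe_le_one_iff (k : K) :
    ‖RescaledCompletion.of K p v hvp (algebraMap K (v.adicCompletion K) k)‖ ≤ 1 ↔ v.valuation K k ≤ 1 := by
  rw [Valued.toNormedField.norm_le_one_iff]
  show Valued.v (k : v.adicCompletion K) ≤ 1 ↔ _
  rw [HeightOneSpectrum.valuedAdicCompletion_eq_valuation']

/-- Dictionary: for an algebraic integer `r`, `‖r‖' < 1` iff `r ∈ v`. [cite: NeukirchANT1999, Ch. II Prop. (3.3)] -/
theorem norm_of_coe_lt_one_iff_mem (r : 𝓞 K) :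
    ‖RescaledCompletion.of K p v hvp (algebraMap K (v.adicCompletion K) (r : K))‖ < 1 ↔ r ∈ v.asIdeal := by
  rw [norm_of_coe_lt_one_iff, show ((r : K)) = algebraMap (𝓞 K) K r from rfl,
    HeightOneSpectrum.valuation_lt_one_iff_mem]

/-- **Discreteness at a generator.** If `v = (π)` is principal, generated by the algebraic integer
`π`, then `π` is a uniformizer of the completion: every `x` with `‖x‖' < 1` has `‖x‖' ≤ ‖π‖'`
(`v(π) = exp(−1)`, Mathlib `intValuation_singleton`, and the value group is `exp(ℤ)`).
[cite: NeukirchANT1999, Ch. II Prop. (3.3)] -/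
theorem norm_le_norm_of_generator {π : 𝓞 K} (hπ : π ≠ 0) (hv : v.asIdeal = Ideal.span {π})
    (x : RescaledCompletion K p v hvp) (hx : ‖x‖ < 1) :
    ‖x‖ ≤ ‖RescaledCompletion.of K p v hvp (algebraMap K (v.adicCompletion K) (π : K))‖ := by
  rw [Valued.toNormedField.norm_lt_one_iff] at hx
  rw [Valued.toNormedField.norm_le_iff]
  have hval : Valued.v (RescaledCompletion.of K p v hvp (algebraMap K (v.adicCompletion K) (π : K))) =
      WithZero.exp (-1 : ℤ) := by
    show Valued.v ((π : K) : v.adicCompletion K) = _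
    rw [HeightOneSpectrum.valuedAdicCompletion_eq_valuation', show ((π : K)) = algebraMap (𝓞 K) K π from rfl,
      HeightOneSpectrum.valuation_of_algebraMap, HeightOneSpectrum.intValuation_singleton v hπ hv]
  rw [hval]
  refine (WithZero.lt_mul_exp_iff_le (WithZero.exp_ne_zero)).mp ?_
  rwa [← WithZero.exp_add, neg_add_cancel, WithZero.exp_zero]

/-- **Approximation by algebraic integers**: every integer `t` of the completion (`‖t‖' ≤ 1`) is
congruent modulo `𝔪_v` to (the image of) some `a ∈ 𝓞 K` — density of `K` (Mathlib
`denseRange_algebraMap`) plus Mathlib's `exists_valuation_sub_lt_of_integer`.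
[cite: NeukirchANT1999, Ch. II Prop. (3.3)] -/
theorem exists_int_norm_sub_lt_one (t : RescaledCompletion K p v hvp) (ht : ‖t‖ ≤ 1) :
    ∃ a : 𝓞 K, ‖t - RescaledCompletion.of K p v hvp (algebraMap K (v.adicCompletion K) (a : K))‖ < 1 := by
  -- density of `K` in the completion, read in the rescaled normed field (same topology)
  have hd : DenseRange (fun k : K => RescaledCompletion.of K p v hvp (algebraMap K (v.adicCompletion K) k)) :=
    (Function.Surjective.denseRange (RescaledCompletion.of K p v hvp).surjective).comp
      (HeightOneSpectrum.denseRange_algebraMap K v) continuous_id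
  obtain ⟨k, hmem⟩ :=
    hd.exists_mem_open isOpen_ball ⟨t, mem_ball_self (zero_lt_one' ℝ)⟩
  rw [mem_ball, dist_eq_norm] at hmem
  -- `k` is a `v`-integer of `K`
  have hk1 : ‖RescaledCompletion.of K p v hvp (algebraMap K (v.adicCompletion K) k)‖ ≤ 1 := by
    have := IsUltrametricDist.norm_add_le_max
      (RescaledCompletion.of K p v hvp (algebraMap K (v.adicCompletion K) k) - t) t
    rw [sub_add_cancel] at this
    exact this.trans (max_le hmem.le ht)
  rw [norm_of_coe_le_one_iff] at hk1
  obtain ⟨a, ha⟩ := v.exists_valuation_sub_lt_of_integer hk1 1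
  refine ⟨a, ?_⟩
  have ha' : ‖RescaledCompletion.of K p v hvp
      (algebraMap K (v.adicCompletion K) (algebraMap (𝓞 K) K a - k))‖ < 1 := by
    rw [norm_of_coe_lt_one_iff]; exact ha
  have hsplit : t - RescaledCompletion.of K p v hvp (algebraMap K (v.adicCompletion K) (a : K)) =
      (t - RescaledCompletion.of K p v hvp (algebraMap K (v.adicCompletion K) k)) +
        -(RescaledCompletion.of K p v hvp (algebraMap K (v.adicCompletion K) (algebraMap (𝓞 K) K a - k))) := by
    rw [map_sub, map_sub]
    show _ = _ + -(RescaledCompletion.of K p v hvp (algebraMap K (v.adicCompletion K) (a : K)) - _)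
    ring
  rw [hsplit]
  refine (IsUltrametricDist.norm_add_le_max _ _).trans_lt (max_lt ?_ ?_)
  · rwa [← norm_neg, neg_sub]
  · rwa [norm_neg]

end Place

/-! ### Residues modulo `ζ₃ − 1` -/

section Residues

variable {K : Type} [Field K] [NumberField K] [hK : IsCyclotomicExtension {3} ℚ K]
variable {ζ : K} (hζ : IsPrimitiveRoot ζ 3)

/-- **`𝓞_{ℚ(ζ₃)} / (ζ₃ − 1) = {0, 1, −1}`**: every algebraic integer of `ℚ(ζ₃)` is congruent to `0`, `1`
or `−1` modulo `λ = ζ₃ − 1` (`𝓞 = ℤ[ζ₃]`, Mathlib `IsCyclotomicExtension.Rat.adjoin_singleton_eq_top`;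
`ζ₃ ≡ 1`, and `λ ∣ 3`, Mathlib `IsPrimitiveRoot.toInteger_sub_one_dvd_prime'`) — Neukirch I (10.1):
`(1 − ζ)` is a prime of residue degree `1` over `p`. [cite: NeukirchANT1999, Ch. I Lemma (10.1)] -/
theorem exists_residue_zeta_sub_one (a : 𝓞 K) :
    ∃ c : ℤ, (c = 0 ∨ c = 1 ∨ c = -1) ∧ hζ.toInteger - 1 ∣ a - c := by
  have hmem : a ∈ Algebra.adjoin ℤ ({hζ.toInteger} : Set (𝓞 K)) := by
    rw [IsCyclotomicExtension.Rat.adjoin_singleton_eq_top hζ]; trivial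
  have h1 : ∃ N : ℤ, hζ.toInteger - 1 ∣ a - N := by
    induction hmem using Algebra.adjoin_induction with
    | mem x hx =>
      rw [Set.mem_singleton_iff] at hx
      subst hx
      exact ⟨1, by simp⟩
    | algebraMap r => exact ⟨r, by simp⟩
    | add x y _ _ hx hy =>
      obtain ⟨N, hN⟩ := hx
      obtain ⟨M, hM⟩ := hy
      refine ⟨N + M, ?_⟩
      have : x + y - ((N + M : ℤ) : 𝓞 K) = (x - N) + (y - M) := by push_cast; ring
      rw [this]
      exact dvd_add hN hM
    | mul x y _ _ hx hy =>
      obtain ⟨N, hN⟩ := hx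
      obtain ⟨M, hM⟩ := hy
      refine ⟨N * M, ?_⟩
      have : x * y - ((N * M : ℤ) : 𝓞 K) = x * (y - M) + (M : 𝓞 K) * (x - N) := by push_cast; ring
      rw [this]
      exact dvd_add (dvd_mul_of_dvd_right hM _) (dvd_mul_of_dvd_right hN _)
  obtain ⟨N, hN⟩ := h1
  have h3 : hζ.toInteger - 1 ∣ (3 : 𝓞 K) := by exact_mod_cast hζ.toInteger_sub_one_dvd_prime'
  -- reduce `N` modulo `3` into `{0, 1, -1}`
  obtain ⟨c, hc, q, hq⟩ : ∃ c : ℤ, (c = 0 ∨ c = 1 ∨ c = -1) ∧ ∃ q : ℤ, N = 3 * q + c := by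
    have h0 : N % 3 = 0 ∨ N % 3 = 1 ∨ N % 3 = 2 := by omega
    rcases h0 with h | h | h
    · exact ⟨0, Or.inl rfl, N / 3, by omega⟩
    · exact ⟨1, Or.inr (Or.inl rfl), N / 3, by omega⟩
    · exact ⟨-1, Or.inr (Or.inr rfl), N / 3 + 1, by omega⟩
  refine ⟨c, hc, ?_⟩
  have : a - (c : 𝓞 K) = (a - N) + (q : 𝓞 K) * 3 := by rw [hq]; push_cast; ring
  rw [this]
  exact dvd_add hN (dvd_mul_of_dvd_right h3 _)

/-- A finite place of `ℚ(ζ₃)` containing `3` IS the place `(ζ₃ − 1)` (Mathlib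
`IsCyclotomicExtension.Rat.eq_span_zeta_sub_one_of_liesOver'`: the unique prime over `3`, totally ramified,
`3𝓞 = (1 − ζ₃)²`). [cite: NeukirchANT1999, Ch. I Lemma (10.1)] -/
theorem asIdeal_eq_span_zeta_sub_one (v : HeightOneSpectrum (𝓞 K)) (h3 : (3 : 𝓞 K) ∈ v.asIdeal) :
    v.asIdeal = Ideal.span {hζ.toInteger - 1} := by
  have hle : Ideal.span {((3 : ℕ) : ℤ)} ≤ v.asIdeal.under ℤ := by
    rw [Ideal.span_le, Set.singleton_subset_iff]
    show algebraMap ℤ (𝓞 K) ((3 : ℕ) : ℤ) ∈ v.asIdeal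
    simpa using h3
  have hmax : (Ideal.span {((3 : ℕ) : ℤ)}).IsMaximal :=
    PrincipalIdealRing.isMaximal_of_irreducible (Nat.prime_iff_prime_int.mp Nat.prime_three).irreducible
  have hne : v.asIdeal.under ℤ ≠ ⊤ := Ideal.comap_ne_top _ v.isPrime.ne_top
  haveI : v.asIdeal.LiesOver (Ideal.span {((3 : ℕ) : ℤ)}) := ⟨hmax.eq_of_le hne hle⟩
  exact IsCyclotomicExtension.Rat.eq_span_zeta_sub_one_of_liesOver' 3 K hζ v.asIdeal

end Residues

/-! ### The twist into `1 + 𝔪_v²` and the bound `‖log u‖ ≤ ‖3‖` -/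

section Bound

variable {K : Type} [Field K] [NumberField K] [hK : IsCyclotomicExtension {3} ℚ K]
variable {ζ : K} (hζ : IsPrimitiveRoot ζ 3)
variable (p : ℕ) [Fact p.Prime] (v : HeightOneSpectrum (𝓞 K)) (hvp : ((p : ℕ) : 𝓞 K) ∈ v.asIdeal)

/-- **The twist.** At the place `v = (ζ₃ − 1)` (and `p = 3`): every principal unit `y` of the completion
satisfies `‖1 − ζ·y‖' ≤ ‖3‖'` for some cube root of unity `ζ ∈ {1, ζ₃, ζ₃²}` — i.e.
`1 + 𝔪_v = μ₃ · (1 + 𝔪_v²)`, `𝔪_v² = 3𝒪_v`: write `1 − y = λ(c + λ s)` with `c ∈ {0, 1, −1}`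
(`exists_residue_zeta_sub_one`, `norm_le_norm_of_generator`) and use `λ² = −3ζ₃`, `ζ₃³ = 1`.
[cite: NeukirchANT1999, Ch. II Prop. (5.5)] -/
theorem exists_twist_norm_le (hp3 : p = 3) (hv : v.asIdeal = Ideal.span {hζ.toInteger - 1})
    (y : RescaledCompletion K p v hvp) (hy : IsPrincipal y) :
    ∃ ζ' : RescaledCompletion K p v hvp, ∃ n : ℕ, 0 < n ∧ ζ' ^ n = 1 ∧
      ‖1 - ζ' * y‖ ≤ ‖(3 : RescaledCompletion K p v hvp)‖ := by
  subst hp3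
  have h3norm : ‖(3 : RescaledCompletion K 3 v hvp)‖ = (3 : ℝ)⁻¹ := by
    simpa using norm_prime 3 (RescaledCompletion K 3 v hvp)
  -- the image `z` of `ζ₃` (along `ι : K → K_v → K_v^{(1/n_v)}`) and `λ = z - 1`
  set e := RescaledCompletion.of K 3 v hvp with he
  set ι : K →+* RescaledCompletion K 3 v hvp := e.toRingHom.comp (algebraMap K (v.adicCompletion K))
    with hι
  have hιe : ∀ k : K, ι k = e (algebraMap K (v.adicCompletion K) k) := fun k => rfl
  set z : RescaledCompletion K 3 v hvp := ι ζ with hz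
  have hz3 : z ^ 3 = 1 := by rw [hz, ← map_pow, hζ.pow_eq_one, map_one]
  have hzsum : z ^ 2 + z + 1 = 0 := by
    have hK0 : ζ ^ 2 + ζ + 1 = 0 := by
      have hne : ζ ≠ 1 := hζ.ne_one (by norm_num)
      have hfac : (ζ - 1) * (ζ ^ 2 + ζ + 1) = 0 := by linear_combination hζ.pow_eq_one
      exact (mul_eq_zero.mp hfac).resolve_left (sub_ne_zero.mpr hne)
    have : ι (ζ ^ 2 + ζ + 1) = z ^ 2 + z + 1 := by rw [hz, map_add, map_add, map_pow, map_one]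
    rw [← this, hK0, map_zero]
  have hz1 : ‖z‖ = 1 := by
    have h1 : ‖z‖ ^ 3 = 1 := by rw [← norm_pow, hz3, norm_one]
    exact (pow_eq_one_iff_of_nonneg (norm_nonneg z) (by norm_num)).mp h1
  have hlam2 : (z - 1) ^ 2 = -3 * z := by linear_combination hzsum
  have hlamnorm : ‖(z - 1) ^ 2‖ = ‖(3 : RescaledCompletion K 3 v hvp)‖ := by
    rw [hlam2, norm_mul, norm_neg, hz1, mul_one]
  -- `λ = z - 1` is the image of the generator `ζ₃ - 1` of `v`
  have hne0 : hζ.toInteger - 1 ≠ 0 := by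
    intro h
    have : (hζ.toInteger : K) = 1 := by
      have := congrArg (fun x : 𝓞 K => (x : K)) (sub_eq_zero.mp h); simpa using this
    exact hζ.ne_one (by norm_num) (by simpa [IsPrimitiveRoot.coe_toInteger] using this)
  have hlam_eq : e (algebraMap K (v.adicCompletion K) (((hζ.toInteger - 1 : 𝓞 K) : K))) = z - 1 := by
    rw [← hιe, hz]
    have : (((hζ.toInteger - 1 : 𝓞 K) : K)) = ζ - 1 := by
      rw [RingOfIntegers.coe_eq_algebraMap, map_sub, map_one]; rfl
    rw [this, map_sub, map_one]
  have hdisc : ∀ x : RescaledCompletion K 3 v hvp, ‖x‖ < 1 → ‖x‖ ≤ ‖z - 1‖ := by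
    intro x hx
    have := norm_le_norm_of_generator 3 v hvp hne0 hv x hx
    rwa [hlam_eq] at this
  have hlam_lt : ‖z - 1‖ < 1 := by
    rw [← hlam_eq, norm_of_coe_lt_one_iff_mem, hv]; exact Ideal.mem_span_singleton_self _
  have hlam0 : z - 1 ≠ 0 := by
    intro h
    have : ‖(3 : RescaledCompletion K 3 v hvp)‖ = 0 := by rw [← hlamnorm, h]; simp
    rw [h3norm] at this
    norm_num at this
  have hlampos : 0 < ‖z - 1‖ := norm_pos_iff.mpr hlam0
  -- `1 - y = λ t` with `‖t‖ ≤ 1`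
  set t := (1 - y) / (z - 1) with ht
  have ht1 : ‖t‖ ≤ 1 := by
    rw [ht, norm_div, div_le_one hlampos]; exact hdisc _ hy
  have hyt : 1 - y = (z - 1) * t := by rw [ht]; field_simp
  -- `t ≡ c (mod λ)`, `c ∈ {0,1,-1}`; `t - c = λ s`, `‖s‖ ≤ 1`
  obtain ⟨a, ha⟩ := exists_int_norm_sub_lt_one 3 v hvp t ht1
  obtain ⟨c, hc, hdvd⟩ := exists_residue_zeta_sub_one hζ a
  have hac : ‖ι (a : K) - (c : RescaledCompletion K 3 v hvp)‖ < 1 := by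
    have h1 : ι (a : K) - (c : RescaledCompletion K 3 v hvp) = ι (((a - c : 𝓞 K)) : K) := by
      simp only [RingOfIntegers.coe_eq_algebraMap, map_sub, map_intCast]
    rw [h1, hιe, norm_of_coe_lt_one_iff_mem, hv]
    exact Ideal.mem_span_singleton.mpr hdvd
  have htc : ‖t - (c : RescaledCompletion K 3 v hvp)‖ < 1 := by
    have : t - (c : RescaledCompletion K 3 v hvp) = (t - ι (a : K)) + (ι (a : K) - c) := by ring
    rw [this]
    refine (IsUltrametricDist.norm_add_le_max _ _).trans_lt (max_lt ?_ hac)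
    rw [hιe]; exact ha
  set s := (t - c) / (z - 1) with hs
  have hs1 : ‖s‖ ≤ 1 := by
    rw [hs, norm_div, div_le_one hlampos]; exact hdisc _ htc
  have hts : t - c = (z - 1) * s := by rw [hs]; field_simp
  have hy' : y = 1 - (c : RescaledCompletion K 3 v hvp) * (z - 1) - (z - 1) ^ 2 * s := by
    linear_combination -hyt - (z - 1) * hts
  have h3le : ‖(z - 1) ^ 2‖ ≤ ‖(3 : RescaledCompletion K 3 v hvp)‖ := hlamnorm.le
  have hzle : ‖z - 1‖ ≤ 1 := hlam_lt.le
  rcases hc with rfl | rfl | rfl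
  · -- `c = 0`: already in `1 + 𝔪²`
    refine ⟨1, 1, one_pos, one_pow 1, ?_⟩
    have : 1 - 1 * y = (z - 1) ^ 2 * s := by rw [hy']; push_cast; ring
    rw [this, norm_mul]
    calc ‖(z - 1) ^ 2‖ * ‖s‖ ≤ ‖(3 : RescaledCompletion K 3 v hvp)‖ * 1 := by gcongr
      _ = _ := mul_one _
  · -- `c = 1`: twist by `ζ₃`
    refine ⟨z, 3, by norm_num, hz3, ?_⟩
    have : 1 - z * y = (z - 1) ^ 2 * (1 + s + (z - 1) * s) := by rw [hy']; push_cast; ring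
    rw [this, norm_mul]
    have hB : ‖1 + s + (z - 1) * s‖ ≤ 1 := by
      refine (IsUltrametricDist.norm_add_le_max _ _).trans (max_le ?_ ?_)
      · exact (IsUltrametricDist.norm_add_le_max _ _).trans (max_le (by rw [norm_one]) hs1)
      · rw [norm_mul]
        calc ‖z - 1‖ * ‖s‖ ≤ 1 * 1 := by gcongr
          _ = 1 := one_mul 1
    calc ‖(z - 1) ^ 2‖ * ‖1 + s + (z - 1) * s‖ ≤ ‖(3 : RescaledCompletion K 3 v hvp)‖ * 1 := by gcongr
      _ = _ := mul_one _
  · -- `c = -1`: twist by `ζ₃²`, using `ζ₃³ = 1`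
    refine ⟨z ^ 2, 3, by norm_num, by rw [← pow_mul, show 2 * 3 = 3 * 2 from rfl, pow_mul, hz3, one_pow], ?_⟩
    have : 1 - z ^ 2 * y = (z - 1) ^ 2 * s * z ^ 2 - (z ^ 3 - 1) := by rw [hy']; push_cast; ring
    rw [this, hz3, sub_self, sub_zero, norm_mul, norm_mul, norm_pow z, hz1, one_pow, mul_one]
    calc ‖(z - 1) ^ 2‖ * ‖s‖ ≤ ‖(3 : RescaledCompletion K 3 v hvp)‖ * 1 := by gcongr
      _ = _ := mul_one _

/-- **`‖log u‖' ≤ ‖3‖'` for every unit of the completion of `ℚ(ζ₃)` at `(ζ₃ − 1)`**, i.e.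
`log(𝒪_v^×) ⊆ 3𝒪_v = 𝔪_v²` — §1 at `ρ = 3⁻¹` (`3⁻¹ · 3^{1/2} ≤ 1`) with the twist of
`exists_twist_norm_le`. (For comparison: the generic `e ≤ p − 1` bound of `UnitLogIntoMaximalIdeal`
only gives `𝔪_v`.) [cite: NeukirchANT1999, Ch. II Prop. (5.5)] -/
theorem norm_unitLog_le_norm_three (hp3 : p = 3) (hv : v.asIdeal = Ideal.span {hζ.toInteger - 1})
    (u : RescaledCompletion K p v hvp) (hu : ‖u‖ = 1) :
    ‖unitLog u‖ ≤ ‖(3 : RescaledCompletion K p v hvp)‖ := by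
  subst hp3
  have h3 : ‖(3 : RescaledCompletion K 3 v hvp)‖ = (3 : ℝ)⁻¹ := by
    simpa using norm_prime 3 (RescaledCompletion K 3 v hvp)
  rw [h3]
  refine norm_unitLog_le_of_forall_isPrincipal_twist 3 (ρ := (3 : ℝ)⁻¹) ?_ ?_ hu
  · have h1 : ((3 : ℕ) : ℝ) ^ (1 / (((3 : ℕ) : ℝ) - 1)) ≤ 3 := by
      have : (1 : ℝ) / (((3 : ℕ) : ℝ) - 1) = 1 / 2 := by norm_num
      rw [this]
      calc ((3 : ℕ) : ℝ) ^ ((1 : ℝ) / 2) ≤ ((3 : ℕ) : ℝ) ^ (1 : ℝ) :=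
            Real.rpow_le_rpow_of_exponent_le (by norm_num) (by norm_num)
        _ = 3 := by norm_num
    have h0 : (0 : ℝ) ≤ ((3 : ℕ) : ℝ) ^ (1 / (((3 : ℕ) : ℝ) - 1)) := Real.rpow_nonneg (by norm_num) _
    nlinarith
  · intro y hy
    obtain ⟨ζ', n, hn, hζ'n, hle⟩ := exists_twist_norm_le hζ 3 v hvp rfl hv y hy
    exact ⟨ζ', n, hn, hζ'n, by rwa [h3] at hle⟩

end Bound

end Literature.IUT.LogVolume.CyclotomicThree

end
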